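import Summits.NavierStokesRegularity.NavierStokesRegularity.Theorems.AxisymmetricExtremalityAxisymmetricKatoGlobalStubSeregin2020TypeIILemma22MoserCutoffs
import Summits.NavierStokesRegularity.NavierStokesRegularity.Theorems.AxisTwistDoorAveragedConeLiouvilleNUGNSLip
import HarnessLib

/-!
# Nazarov–Uraltseva 2011 §3 over LIPSCHITZ slices (T1 of cell pub/ns-inputs), piece M1ᴸ — tools:
# a.e. chain rules for the slice `w = η^{1/2}(l-Φ)₊^{q/2}φ³`, its Lipschitz bound, and the joint
# (a.e.-)measurability / a.e.-differentiability of slice gradients of a Lipschitz-sliced function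

Seat ns-s29-p2 g4 (plan g6 key, pub/ns-inputs/STATUS 2026-08-28T13:50:14Z; ser-a g2's PORT MAP (a)–(d),
`kits/N4-T1-plan.md` v2 §6).  The landed axis-free Moser step `NU.nu_moserStep` (p633639) uses the slice
clause `∀ᵐ t, ContDiff ℝ 1 (Φ t)` of `NUStanding` in exactly one file (`…NUMoserEmbedding.lean`); over the
Lipschitz class `NUStandingLip` (`…NULipDefs`) the same argument runs with the four replacements typed here:

* `sq_norm_fderiv_posPart_rpow_half_comp_le_of_differentiableAt`,
  `sq_norm_fderiv_wSlice_le_of_differentiableAt` — the POINTWISE twins of the tree's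
  `sq_norm_fderiv_posPart_rpow_half_comp_le` / `sq_norm_fderiv_wSlice_le` (`…Lemma22MoserCutoffs`): at a point
  where the slice `Ψ` is differentiable, `x ↦ c^{1/2}((l-Ψ x)₊)^{q/2}φ(x)³` is differentiable and
  `‖Dw‖² ≤ c H''(Ψ)‖∇Ψ‖²(φ³)² + 18c((l-Ψ)₊)^q‖Dφ‖²` (same proof, the chain rule taken at the point);
* `exists_lipschitzWith_wSlice` — for a Lipschitz slice `Ψ ≥ 0` and the `C¹` cut-off `φ` (`0 ≤ φ ≤ 1`,
  `‖Dφ‖ ≤ L_φ`) the slice `w` is globally Lipschitz (`τ ↦ ((l-τ)₊)^{q/2}` is Lipschitz on `[0,∞)` by the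
  mean value theorem, `lipschitzOnWith_posPart_const_sub_rpow_half`; product of two bounded Lipschitz
  factors, the second one `c^{1/2}φ³` being `C¹` with bounded gradient);
* `ae_prod_differentiableAt_slice_of_continuousOn` — if `uncurry g` is continuous on `S × ℝ³` (`S` open)
  and `ν`-a.e. `s ∈ S` has `g s` differentiable a.e. (Rademacher for Lipschitz slices), then
  `(s,x) ↦ g s` is differentiable at `x` for `(ν ⊗ vol)`-a.e. `(s,x)` — the measurability of the
  differentiability set is Mathlib's `measurableSet_of_differentiableAt_with_param` on the subtype `S`,
  transported along the measurable embedding `S × ℝ³ → ℝ × ℝ³`;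
* `aestronglyMeasurable_fderiv_slice_of_ae_differentiableAt` — the tree's
  `aestronglyMeasurable_fderiv_slice_of_ae_differentiable` (`…Lemma22GradientMeasurability`, whose route-file
  import is avoided here: the coordinate decomposition is ser-a's `NU.clm_eq_sum_smul_proj`, p636788) with its
  first line removed: the hypothesis is directly `∀ᵐ z, DifferentiableAt ℝ (Φ z.1) z.2` (proof verbatim:
  difference quotients along `eᵢ/n`).

WHAT THIS IS NOT: no Navier–Stokes statement; calculus/measure-theory bricks of the re-proof of the INPUT
`NazarovUraltseva2011_positivity_propagation` (N4/T1); item 26889 and the summit stay open.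
[cite: NazarovUraltseva2011HarnackDivFree, §3 (arXiv pp. 8–10)] [cite: LeiRenTian2025, Lemma 2.5]
-/

-- the problem directory repeats the summit name (D-0017); core's `dupNamespace` linter fires
set_option linter.dupNamespace false

noncomputable section

open MeasureTheory Set Function Filter Topology Metric
open scoped NNReal ENNReal RealInnerProductSpace

namespace Summit.NavierStokesRegularity.NavierStokesRegularity.Theorems.AveragedConeLiouville.NU

open Literature.Analysis.FluidPDE Literature.Analysis.FluidPDE.LeiZhang2011
open Summit.NavierStokesRegularity.NavierStokesRegularity.Theorems.AxisymmetricKatoGlobal.EulerScaling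

/-! ### Pointwise chain rules at a point of differentiability of the slice -/

/-- **Chain rule for `v = s(Ψ)`, `s(τ) = ((l-τ)₊)^{q/2}`, `q > 2`, at a point of differentiability of
`Ψ`**: `x ↦ ((l - Ψ x)₊)^{q/2}` is differentiable at `x` and
`‖D((l-Ψ)₊^{q/2})(x)‖² ≤ ½ H''(Ψ x) ‖∇Ψ(x)‖²`, `H = ((l-·)₊)^q` (pointwise twin of
`sq_norm_fderiv_posPart_rpow_half_comp_le`). [cite: NazarovUraltseva2012, proof of Lemma 3.1, (3.2)] -/
theorem sq_norm_fderiv_posPart_rpow_half_comp_le_of_differentiableAt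
    {Ψ : EuclideanSpace ℝ (Fin 3) → ℝ} {x : EuclideanSpace ℝ (Fin 3)} (hΨd : DifferentiableAt ℝ Ψ x)
    {q : ℝ} (hq : 2 < q) (l : ℝ) :
    DifferentiableAt ℝ (fun x => max (l - Ψ x) 0 ^ (q / 2)) x ∧
    ‖fderiv ℝ (fun x => max (l - Ψ x) 0 ^ (q / 2)) x‖ ^ 2 ≤
      1 / 2 * deriv (deriv fun τ : ℝ => max (l - τ) 0 ^ q) (Ψ x) * ‖gradient Ψ x‖ ^ 2 := by
  set s : ℝ → ℝ := fun τ => max (l - τ) 0 ^ (q / 2) with hs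
  have hs1 : ContDiff ℝ 1 s := contDiff_one_posPart_const_sub_rpow_half hq l
  have hsd : DifferentiableAt ℝ s (Ψ x) := hs1.differentiable one_ne_zero _
  have hcomp : HasFDerivAt (fun x => max (l - Ψ x) 0 ^ (q / 2)) (deriv s (Ψ x) • fderiv ℝ Ψ x) x :=
    hsd.hasDerivAt.comp_hasFDerivAt x hΨd.hasFDerivAt
  refine ⟨hcomp.differentiableAt, ?_⟩
  rw [hcomp.fderiv, norm_smul, Real.norm_eq_abs, mul_pow, sq_abs, gradient,
    LinearIsometryEquiv.norm_map]
  have key := two_mul_deriv_posPart_const_sub_rpow_half_sq_le hq l (Ψ x)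
  have hn : 0 ≤ ‖fderiv ℝ Ψ x‖ ^ 2 := sq_nonneg _
  nlinarith

/-- **The slice of `w = η^{1/2} v φ³` and its gradient at a point of differentiability of `Ψ`**:
`q > 2`, `0 ≤ c`, `φ ∈ C¹` with `0 ≤ φ ≤ 1`; then `x ↦ c^{1/2} ((l - Ψ x)₊)^{q/2} φ(x)³` is
differentiable at `x` and `‖D w‖² ≤ c H''(Ψ)‖∇Ψ‖² (φ³)² + 18 c ((l-Ψ)₊)^q ‖Dφ‖²` there (pointwise
twin of `sq_norm_fderiv_wSlice_le`, same algebra). [cite: NazarovUraltseva2012, proof of Lemma 3.1, (3.3)–(3.5)] -/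
theorem sq_norm_fderiv_wSlice_le_of_differentiableAt {Ψ φ : EuclideanSpace ℝ (Fin 3) → ℝ}
    {x : EuclideanSpace ℝ (Fin 3)} (hΨd : DifferentiableAt ℝ Ψ x)
    (hφ : ContDiff ℝ 1 φ) (hφ01 : ∀ y, 0 ≤ φ y ∧ φ y ≤ 1) {q : ℝ} (hq : 2 < q) (l : ℝ) {c : ℝ}
    (hc : 0 ≤ c) :
    DifferentiableAt ℝ (fun x => c ^ ((1 : ℝ) / 2) * max (l - Ψ x) 0 ^ (q / 2) * φ x ^ 3) x ∧
    ‖fderiv ℝ (fun x => c ^ ((1 : ℝ) / 2) * max (l - Ψ x) 0 ^ (q / 2) * φ x ^ 3) x‖ ^ 2 ≤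
      c * (deriv (deriv fun τ : ℝ => max (l - τ) 0 ^ q) (Ψ x) * ‖gradient Ψ x‖ ^ 2 *
        (φ x ^ 3) ^ 2) + 18 * c * max (l - Ψ x) 0 ^ q * ‖fderiv ℝ φ x‖ ^ 2 := by
  obtain ⟨hvd, hvD⟩ := sq_norm_fderiv_posPart_rpow_half_comp_le_of_differentiableAt hΨd hq l
  set v : EuclideanSpace ℝ (Fin 3) → ℝ := fun x => max (l - Ψ x) 0 ^ (q / 2) with hv
  have hφ3 : ContDiff ℝ 1 (fun x => φ x ^ 3) := hφ.pow 3
  have hφd : Differentiable ℝ φ := hφ.differentiable one_ne_zero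
  have hφ3d : DifferentiableAt ℝ (fun x => φ x ^ 3) x := hφ3.differentiable one_ne_zero x
  have e1 : (fun x => c ^ ((1 : ℝ) / 2) * max (l - Ψ x) 0 ^ (q / 2) * φ x ^ 3) =
      fun x => c ^ ((1 : ℝ) / 2) * (v x * φ x ^ 3) := by funext y; simp only [hv]; ring
  have hprodAt : HasFDerivAt (fun x => c ^ ((1 : ℝ) / 2) * (v x * φ x ^ 3))
      (c ^ ((1 : ℝ) / 2) • (v x • fderiv ℝ (fun x => φ x ^ 3) x + φ x ^ 3 • fderiv ℝ v x)) x :=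
    (hvd.hasFDerivAt.mul hφ3d.hasFDerivAt).const_mul (c ^ ((1 : ℝ) / 2))
  refine ⟨by rw [e1]; exact hprodAt.differentiableAt, ?_⟩
  rw [e1, hprodAt.fderiv, norm_smul, Real.norm_of_nonneg (Real.rpow_nonneg hc _), mul_pow,
    ← Real.rpow_natCast (c ^ ((1 : ℝ) / 2)) 2, ← Real.rpow_mul hc]
  norm_num
  -- `‖a + b‖² ≤ 2‖a‖² + 2‖b‖²`
  have hv0 : 0 ≤ v x := Real.rpow_nonneg (le_max_right _ _) _
  have hφ3le : φ x ^ 3 ≤ 1 := pow_le_one₀ (hφ01 x).1 (hφ01 x).2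
  have hφ30 : 0 ≤ φ x ^ 3 := pow_nonneg (hφ01 x).1 3
  have hA : ‖v x • fderiv ℝ (fun x => φ x ^ 3) x‖ ≤ v x * (3 * ‖fderiv ℝ φ x‖) := by
    rw [norm_smul, Real.norm_of_nonneg hv0, fderiv_pow_three hφd, norm_smul, Real.norm_eq_abs,
      abs_of_nonneg (by nlinarith [(hφ01 x).1])]
    refine mul_le_mul_of_nonneg_left ?_ hv0
    have : φ x ^ 2 ≤ 1 := pow_le_one₀ (hφ01 x).1 (hφ01 x).2
    nlinarith [norm_nonneg (fderiv ℝ φ x)]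
  have hB : ‖φ x ^ 3 • fderiv ℝ v x‖ ≤ φ x ^ 3 * ‖fderiv ℝ v x‖ := by
    rw [norm_smul, Real.norm_of_nonneg hφ30]
  have hsum : ‖v x • fderiv ℝ (fun x => φ x ^ 3) x + φ x ^ 3 • fderiv ℝ v x‖ ≤
      v x * (3 * ‖fderiv ℝ φ x‖) + φ x ^ 3 * ‖fderiv ℝ v x‖ :=
    (norm_add_le _ _).trans (add_le_add hA hB)
  have hsq : ‖v x • fderiv ℝ (fun x => φ x ^ 3) x + φ x ^ 3 • fderiv ℝ v x‖ ^ 2 ≤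
      2 * (v x * (3 * ‖fderiv ℝ φ x‖)) ^ 2 + 2 * (φ x ^ 3 * ‖fderiv ℝ v x‖) ^ 2 := by
    calc ‖v x • fderiv ℝ (fun x => φ x ^ 3) x + φ x ^ 3 • fderiv ℝ v x‖ ^ 2
        ≤ (v x * (3 * ‖fderiv ℝ φ x‖) + φ x ^ 3 * ‖fderiv ℝ v x‖) ^ 2 :=
          pow_le_pow_left₀ (norm_nonneg _) hsum 2
      _ ≤ _ := by nlinarith [sq_nonneg (v x * (3 * ‖fderiv ℝ φ x‖) - φ x ^ 3 * ‖fderiv ℝ v x‖)]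
  -- `v² = ((l-Ψ)₊)^q` and `‖Dv‖² ≤ ½ H'' ‖∇Ψ‖²`
  have hv2 : v x ^ 2 = max (l - Ψ x) 0 ^ q := posPart_const_sub_rpow_half_sq q l (Ψ x)
  have hH'' : 0 ≤ deriv (deriv fun τ : ℝ => max (l - τ) 0 ^ q) (Ψ x) :=
    deriv_deriv_posPart_const_sub_rpow_nonneg hq l (Ψ x)
  have hφ6 : (φ x ^ 3) ^ 2 ≤ 1 := pow_le_one₀ hφ30 hφ3le
  calc c * ‖v x • fderiv ℝ (fun x => φ x ^ 3) x + φ x ^ 3 • fderiv ℝ v x‖ ^ 2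
      ≤ c * (2 * (v x * (3 * ‖fderiv ℝ φ x‖)) ^ 2 + 2 * (φ x ^ 3 * ‖fderiv ℝ v x‖) ^ 2) :=
        mul_le_mul_of_nonneg_left hsq hc
    _ = 18 * c * v x ^ 2 * ‖fderiv ℝ φ x‖ ^ 2 + 2 * c * ((φ x ^ 3) ^ 2 * ‖fderiv ℝ v x‖ ^ 2) := by
        ring
    _ ≤ 18 * c * max (l - Ψ x) 0 ^ q * ‖fderiv ℝ φ x‖ ^ 2 +
          2 * c * ((φ x ^ 3) ^ 2 * (1 / 2 * deriv (deriv fun τ : ℝ => max (l - τ) 0 ^ q) (Ψ x) *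
            ‖gradient Ψ x‖ ^ 2)) := by
        rw [hv2]
        gcongr
    _ = c * (deriv (deriv fun τ : ℝ => max (l - τ) 0 ^ q) (Ψ x) * ‖gradient Ψ x‖ ^ 2 *
          (φ x ^ 3) ^ 2) + 18 * c * max (l - Ψ x) 0 ^ q * ‖fderiv ℝ φ x‖ ^ 2 := by ring

/-! ### The slice is Lipschitz -/

/-- **`τ ↦ ((l-τ)₊)^{q/2}` is Lipschitz on `[0, ∞)`** with constant `(q/2) l^{q/2-1}` (`q > 2`,
`l > 0`): its derivative there is `-(q/2)((l-τ)₊)^{q/2-1}`, of size `≤ (q/2) l^{q/2-1}`; mean value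
theorem on the convex set `[0,∞)`. [folklore] -/
theorem lipschitzOnWith_posPart_const_sub_rpow_half {q l : ℝ} (hq : 2 < q) (hl : 0 < l) :
    LipschitzOnWith ⟨q / 2 * l ^ (q / 2 - 1), by positivity⟩
      (fun τ : ℝ => max (l - τ) 0 ^ (q / 2)) (Ici 0) := by
  have hs1 : ContDiff ℝ 1 (fun τ : ℝ => max (l - τ) 0 ^ (q / 2)) :=
    contDiff_one_posPart_const_sub_rpow_half hq l
  refine Convex.lipschitzOnWith_of_nnnorm_deriv_le
    (fun τ _ => hs1.differentiable one_ne_zero τ) (fun τ hτ => ?_) (convex_Ici 0)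
  have hder : deriv (fun τ : ℝ => max (l - τ) 0 ^ (q / 2)) τ = -(q / 2 * max (l - τ) 0 ^ (q / 2 - 1)) := by
    rw [deriv_comp_const_sub (f := fun y : ℝ => max y 0 ^ (q / 2)), deriv_posPart_rpow_half hq]
  rw [← NNReal.coe_le_coe, coe_nnnorm, hder, norm_neg, Real.norm_of_nonneg (by positivity)]
  show q / 2 * max (l - τ) 0 ^ (q / 2 - 1) ≤ q / 2 * l ^ (q / 2 - 1)
  refine mul_le_mul_of_nonneg_left ?_ (by linarith)
  have hτ0 : 0 ≤ τ := hτ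
  exact Real.rpow_le_rpow (le_max_right _ _) (max_le (by linarith) hl.le) (by linarith)

/-- **The slice `w = c^{1/2}((l-Ψ)₊)^{q/2}φ³` of a Lipschitz, non-negative `Ψ` is Lipschitz**
(`φ ∈ C¹`, `0 ≤ φ ≤ 1`, `‖Dφ‖ ≤ L_φ`, `q > 2`, `l > 0`, `c ≥ 0`): the factor `((l-Ψ)₊)^{q/2}` is Lipschitz
(previous lemma ∘ `Ψ ≥ 0`) and bounded by `l^{q/2}`, the factor `c^{1/2}φ³` is `C¹` with
`‖D(c^{1/2}φ³)‖ ≤ 3c^{1/2}L_φ` (`lipschitzWith_of_nnnorm_fderiv_le`) and bounded by `c^{1/2}`; product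
estimate `|FG(x) − FG(y)| ≤ |F(x)||G(x)−G(y)| + |F(x)−F(y)||G(y)|`. [folklore] -/
theorem exists_lipschitzWith_wSlice {Ψ φ : EuclideanSpace ℝ (Fin 3) → ℝ} {L : ℝ≥0}
    (hΨ : LipschitzWith L Ψ) (hΨ0 : ∀ x, 0 ≤ Ψ x) (hφ : ContDiff ℝ 1 φ)
    (hφ01 : ∀ y, 0 ≤ φ y ∧ φ y ≤ 1) {Lφ : ℝ} (hLφ : ∀ x, ‖fderiv ℝ φ x‖ ≤ Lφ)
    {q : ℝ} (hq : 2 < q) {l : ℝ} (hl : 0 < l) {c : ℝ} (hc : 0 ≤ c) :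
    ∃ Kw : ℝ≥0, LipschitzWith Kw
      (fun x => c ^ ((1 : ℝ) / 2) * max (l - Ψ x) 0 ^ (q / 2) * φ x ^ 3) := by
  -- the factor `F = ((l-Ψ)₊)^{q/2}`: Lipschitz and bounded
  set F : EuclideanSpace ℝ (Fin 3) → ℝ := fun x => max (l - Ψ x) 0 ^ (q / 2) with hF
  have hs := lipschitzOnWith_posPart_const_sub_rpow_half hq hl
  have hFlip : LipschitzWith (⟨q / 2 * l ^ (q / 2 - 1), by positivity⟩ * L) F := by
    rw [← lipschitzOnWith_univ]
    exact hs.comp hΨ.lipschitzOnWith (fun x _ => hΨ0 x)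
  have hF0 : ∀ x, 0 ≤ F x := fun x => Real.rpow_nonneg (le_max_right _ _) _
  have hFb : ∀ x, |F x| ≤ l ^ (q / 2) := fun x => by
    rw [abs_of_nonneg (hF0 x)]
    exact Real.rpow_le_rpow (le_max_right _ _) (max_le (by linarith [hΨ0 x]) hl.le) (by linarith)
  -- the factor `G = c^{1/2} φ³`: `C¹`, bounded derivative, bounded
  set G : EuclideanSpace ℝ (Fin 3) → ℝ := fun x => c ^ ((1 : ℝ) / 2) * φ x ^ 3 with hG
  have hφd : Differentiable ℝ φ := hφ.differentiable one_ne_zero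
  have hLφ0 : 0 ≤ Lφ := (norm_nonneg _).trans (hLφ 0)
  have hGd : Differentiable ℝ G := (hφd.pow 3).const_mul _
  have hGD : ∀ x, ‖fderiv ℝ G x‖ ≤ c ^ ((1 : ℝ) / 2) * (3 * Lφ) := by
    intro x
    have h : fderiv ℝ G x = c ^ ((1 : ℝ) / 2) • fderiv ℝ (fun z => φ z ^ 3) x := by
      rw [hG]
      exact fderiv_const_mul ((hφd.pow 3) x) _
    rw [h, fderiv_pow_three hφd, norm_smul, norm_smul, Real.norm_of_nonneg (Real.rpow_nonneg hc _),
      Real.norm_eq_abs, abs_of_nonneg (by nlinarith [(hφ01 x).1])]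
    refine mul_le_mul_of_nonneg_left ?_ (Real.rpow_nonneg hc _)
    have : φ x ^ 2 ≤ 1 := pow_le_one₀ (hφ01 x).1 (hφ01 x).2
    nlinarith [norm_nonneg (fderiv ℝ φ x), hLφ x]
  have hGlip : LipschitzWith ⟨c ^ ((1 : ℝ) / 2) * (3 * Lφ), by positivity⟩ G :=
    lipschitzWith_of_nnnorm_fderiv_le hGd fun x => by
      rw [← NNReal.coe_le_coe, coe_nnnorm]; exact hGD x
  have hGb : ∀ x, |G x| ≤ c ^ ((1 : ℝ) / 2) := fun x => by
    rw [hG, abs_of_nonneg (mul_nonneg (Real.rpow_nonneg hc _) (pow_nonneg (hφ01 x).1 3))]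
    have : φ x ^ 3 ≤ 1 := pow_le_one₀ (hφ01 x).1 (hφ01 x).2
    nlinarith [Real.rpow_nonneg hc ((1 : ℝ) / 2)]
  -- the product, with real constants
  set KF : ℝ := q / 2 * l ^ (q / 2 - 1) * L with hKF
  set KG : ℝ := c ^ ((1 : ℝ) / 2) * (3 * Lφ) with hKG
  have hKF0 : 0 ≤ KF := by positivity
  have hKG0 : 0 ≤ KG := by positivity
  have hFd : ∀ x y, |F x - F y| ≤ KF * dist x y := fun x y => by
    have h := hFlip.dist_le_mul x y
    rw [Real.dist_eq, NNReal.coe_mul] at h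
    exact h
  have hGdist : ∀ x y, |G x - G y| ≤ KG * dist x y := fun x y => by
    have h := hGlip.dist_le_mul x y
    rw [Real.dist_eq] at h
    exact h
  set Cw : ℝ := l ^ (q / 2) * KG + KF * c ^ ((1 : ℝ) / 2) with hCw
  have hCw0 : 0 ≤ Cw := by positivity
  have hprod : LipschitzWith (Real.toNNReal Cw) (fun x => F x * G x) := by
    refine LipschitzWith.of_dist_le_mul fun x y => ?_
    rw [Real.coe_toNNReal _ hCw0, Real.dist_eq]
    have e : F x * G x - F y * G y = F x * (G x - G y) + (F x - F y) * G y := by ring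
    rw [e]
    refine (abs_add_le _ _).trans ?_
    rw [abs_mul, abs_mul]
    have h1 : |F x| * |G x - G y| ≤ l ^ (q / 2) * (KG * dist x y) :=
      mul_le_mul (hFb x) (hGdist x y) (abs_nonneg _) (by positivity)
    have h2 : |F x - F y| * |G y| ≤ (KF * dist x y) * c ^ ((1 : ℝ) / 2) :=
      mul_le_mul (hFd x y) (hGb y) (abs_nonneg _) (by positivity)
    refine (add_le_add h1 h2).trans (le_of_eq ?_)
    rw [hCw]
    ring
  refine ⟨Real.toNNReal Cw, ?_⟩
  have e : (fun x => c ^ ((1 : ℝ) / 2) * max (l - Ψ x) 0 ^ (q / 2) * φ x ^ 3) = fun x => F x * G x := by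
    funext x; simp only [hF, hG]; ring
  rw [e]
  exact hprod

/-! ### Joint a.e.-differentiability and measurability of slice gradients -/

/-- **Product-a.e. differentiability of the slices** of a function `g : ℝ → ℝ³ → ℝ` jointly continuous
on `S × ℝ³` (`S ⊆ ℝ` open): if `ν`-a.e. `s` lies in `S` and has `g s` differentiable at a.e. point
(e.g. `g s` Lipschitz — Rademacher), then `g z.1` is differentiable at `z.2` for `(ν ⊗ vol)`-a.e. `z`.
(The differentiability set is measurable: Mathlib's `measurableSet_of_differentiableAt_with_param` on the
subtype `S`, transported by the measurable embedding `S × ℝ³ ↪ ℝ × ℝ³`; then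
`Measure.ae_prod_mem_iff_ae_ae_mem`.) [folklore] -/
theorem ae_prod_differentiableAt_slice_of_continuousOn
    {g : ℝ → EuclideanSpace ℝ (Fin 3) → ℝ} {S : Set ℝ} (hS : IsOpen S)
    (hcont : ContinuousOn (uncurry g) (S ×ˢ (univ : Set (EuclideanSpace ℝ (Fin 3)))))
    (ν : Measure ℝ) [SFinite ν] (hν : ∀ᵐ s ∂ν, s ∈ S)
    (hdiff : ∀ᵐ s ∂ν, ∀ᵐ x ∂(volume : Measure (EuclideanSpace ℝ (Fin 3))),
      DifferentiableAt ℝ (g s) x) :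
    ∀ᵐ z ∂(ν.prod (volume : Measure (EuclideanSpace ℝ (Fin 3)))), DifferentiableAt ℝ (g z.1) z.2 := by
  -- measurability of the differentiability set over `S`
  have hD : MeasurableSet {z : ℝ × EuclideanSpace ℝ (Fin 3) | z.1 ∈ S ∧ DifferentiableAt ℝ (g z.1) z.2} := by
    set f : S → EuclideanSpace ℝ (Fin 3) → ℝ := fun s x => g s x with hf
    have hfc : Continuous f.uncurry := by
      have e : f.uncurry = uncurry g ∘ (fun p : S × EuclideanSpace ℝ (Fin 3) => ((p.1 : ℝ), p.2)) := by
        funext p; rfl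
      rw [e]
      exact hcont.comp_continuous (continuous_subtype_val.prodMap continuous_id)
        (fun p => ⟨p.1.2, mem_univ _⟩)
    have hm := measurableSet_of_differentiableAt_with_param ℝ hfc
    have hι : MeasurableEmbedding
        (Prod.map ((↑) : S → ℝ) (id : EuclideanSpace ℝ (Fin 3) → EuclideanSpace ℝ (Fin 3))) :=
      (MeasurableEmbedding.subtype_coe hS.measurableSet).prodMap MeasurableEmbedding.id
    have himg : Prod.map ((↑) : S → ℝ) (id : EuclideanSpace ℝ (Fin 3) → EuclideanSpace ℝ (Fin 3)) ''
        {p : S × EuclideanSpace ℝ (Fin 3) | DifferentiableAt ℝ (f p.1) p.2} =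
        {z : ℝ × EuclideanSpace ℝ (Fin 3) | z.1 ∈ S ∧ DifferentiableAt ℝ (g z.1) z.2} := by
      ext z
      constructor
      · rintro ⟨p, hp, rfl⟩
        exact ⟨p.1.2, hp⟩
      · rintro ⟨hz1, hz2⟩
        exact ⟨(⟨z.1, hz1⟩, z.2), hz2, rfl⟩
    rw [← himg]
    exact hι.measurableSet_image.2 hm
  have h1 : ∀ᵐ z ∂(ν.prod (volume : Measure (EuclideanSpace ℝ (Fin 3)))),
      z ∈ {z : ℝ × EuclideanSpace ℝ (Fin 3) | z.1 ∈ S ∧ DifferentiableAt ℝ (g z.1) z.2} := by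
    rw [Measure.ae_prod_mem_iff_ae_ae_mem hD]
    filter_upwards [hν, hdiff] with s hs hd
    filter_upwards [hd] with x hx
    exact ⟨hs, hx⟩
  exact h1.mono fun z hz => hz.2

/-- **Joint a.e.-measurability of the slice gradient from a.e. differentiability** (the tree's
`aestronglyMeasurable_fderiv_slice_of_ae_differentiable` with the everywhere-differentiability of a.e.
slice replaced by product-a.e. differentiability; proof verbatim: measurable difference quotients along
`eᵢ/n` converge to `∂ᵢ` at every point of differentiability, Mathlib's `HasFDerivAt.lim`). [folklore] -/
theorem aestronglyMeasurable_fderiv_slice_of_ae_differentiableAt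
    {Φ : ℝ → EuclideanSpace ℝ (Fin 3) → ℝ} (hΦ : Measurable (uncurry Φ))
    (μ : Measure ℝ) (ν : Measure (EuclideanSpace ℝ (Fin 3))) [SFinite μ] [SFinite ν]
    (hae : ∀ᵐ z ∂(μ.prod ν), DifferentiableAt ℝ (Φ z.1) z.2) :
    AEStronglyMeasurable (fun z : ℝ × EuclideanSpace ℝ (Fin 3) => fderiv ℝ (Φ z.1) z.2)
      (μ.prod ν) := by
  -- the coordinate derivatives are a.e.-measurable (limits of difference quotients)
  have hcoord : ∀ i : Fin 3, AEMeasurable (fun z : ℝ × EuclideanSpace ℝ (Fin 3) =>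
      fderiv ℝ (Φ z.1) z.2 (EuclideanSpace.single i (1 : ℝ))) (μ.prod ν) := by
    intro i
    set e : EuclideanSpace ℝ (Fin 3) := EuclideanSpace.single i (1 : ℝ) with he
    set q : ℕ → ℝ × EuclideanSpace ℝ (Fin 3) → ℝ := fun n z =>
      ((n : ℝ) + 1) * (Φ z.1 (z.2 + ((n : ℝ) + 1)⁻¹ • e) - Φ z.1 z.2) with hq
    have hqm : ∀ n, AEMeasurable (q n) (μ.prod ν) := by
      intro n
      have h1 : Measurable fun z : ℝ × EuclideanSpace ℝ (Fin 3) =>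
          Φ z.1 (z.2 + ((n : ℝ) + 1)⁻¹ • e) := by
        have hs : Measurable fun z : ℝ × EuclideanSpace ℝ (Fin 3) =>
            ((z.1, z.2 + ((n : ℝ) + 1)⁻¹ • e) : ℝ × EuclideanSpace ℝ (Fin 3)) :=
          measurable_fst.prodMk (measurable_snd.add_const _)
        exact hΦ.comp hs
      have h2 : Measurable fun z : ℝ × EuclideanSpace ℝ (Fin 3) => Φ z.1 z.2 := hΦ
      exact ((h1.sub h2).const_mul _).aemeasurable
    refine aemeasurable_of_tendsto_metrizable_ae (u := atTop) hqm ?_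
    filter_upwards [hae] with z hz
    have hc : Tendsto (fun n : ℕ => ‖((n : ℝ) + 1)‖) atTop atTop := by
      have h : Tendsto (fun n : ℕ => (n : ℝ) + 1) atTop atTop :=
        tendsto_atTop_add_const_right _ 1 tendsto_natCast_atTop_atTop
      refine (tendsto_atTop_mono (fun n => ?_) h)
      exact Real.le_norm_self _
    have hlim := hz.hasFDerivAt.lim e hc
    simpa only [hq, smul_eq_mul] using hlim
  -- assemble the functional from its coordinates
  have hsum : (fun z : ℝ × EuclideanSpace ℝ (Fin 3) => fderiv ℝ (Φ z.1) z.2) =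
      ∑ i : Fin 3, fun z : ℝ × EuclideanSpace ℝ (Fin 3) =>
        fderiv ℝ (Φ z.1) z.2 (EuclideanSpace.single i (1 : ℝ)) •
          (EuclideanSpace.proj i : EuclideanSpace ℝ (Fin 3) →L[ℝ] ℝ) := by
    funext z
    rw [Finset.sum_apply]
    exact clm_eq_sum_smul_proj _
  rw [hsum]
  refine Finset.aestronglyMeasurable_sum _ fun i _ => ?_
  exact (hcoord i).aestronglyMeasurable.smul_const _

end Summit.NavierStokesRegularity.NavierStokesRegularity.Theorems.AveragedConeLiouville.NU

end
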